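import Literature.NumberTheory.EllipticCurves.TianYuanZhang2017.GenusPointDescentDisplays
import HarnessLib

/-!
# Tian–Yuan–Zhang 2017 §3.1–3.2 AS PRINTED, block by block: the CM points `z_d = f_d(P_d)` behind the genus points
# `Z(d)`, the groups `Cl′_d ⊃ 2Cl′_d ⊃ Φ₀`, `Gal(ℍ′_n/H_d) ⊃ Gal(ℍ′_n/H′_d)`, the elements `σ`, `σ_{1+ϖ}`, complex
# conjugation, and the printed sentences Prop. 3.2 (1)(2)(3), Thm. 3.6 (1)(2), p. 759 — DISPLAYS (nothing asserted)

Companion to `GenusPointDescentDisplays.lean` (`structure GenusPointData n`, `GenusPointData.Printed`,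
`tyz_genusPointData`): that file displays the genus points `Z(d₀)` of [TianYuanZhang2017] §3 as ABSTRACT points with
Prop. 3.4 / Thm. 3.5 / Lemma 3.18 / Lemma 3.21 and the Galois facts on `β′`; it deliberately does NOT display the CM points
`z_n = f_n(P_n)`, the class groups `Cl′_n`, the element `σ`, or Thm. 3.6 (the Galois action on `z_n`).  THIS file displays
exactly that layer, for EVERY block `d ∣ n`, `d ≡ 5, 6, 7 (mod 8)`, of the data `D : GenusPointData n`, as ONE predicate
`GenusPointData.CMPointGaloisPrinted D` whose conjuncts are sentences printed in §3.1–3.2 and on p. 759 of the source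
(or, for the two genus-theory words the source uses without statement, the textbook theorems it relies on — flagged
below), read on named objects of `Gal(ℍ′_n/ℚ) = (D.H ≃ₐ[ℚ] D.H)` acting on `A(ℍ′_n)`; and ONE named fact
`tyz_cmPointGaloisData` («for every square-free `n ≡ 5, 6, 7 (mod 8)` there are data with `Printed ∧ CMPointGaloisPrinted`»),
which implies `tyz_genusPointData` (`tyz_genusPointData_of_cmPointGaloisData`).  HONEST FRAMING: nothing is asserted
(no `_holds`; the objects — CM points on `X_U → A`, ring class fields, the Artin map — are not constructed in the tree);
no count moves; consumers take `(h : tyz_cmPointGaloisData)` as an explicit hypothesis.  Origin: cell `bsd-monsky`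
(run/shared/lean/pub/bsd-monsky/), prover-B seat: the specialisation of this display to `n = 2pq` (blocks `2pq`, `p`,
`pq`/`q`) is the Summits-side predicate `P2.thetaCMPrintedSpec` (read conjunct by conjunct against print by the cell's
literature seat, HOME/lit «ADDENDUM 13 §D», 13/13 MATCH); this file states the same sentences for general `n`, which is
how the source prints them ("Assume that `n ≡ 5 (mod 8)` …", every block `d` being such an `n`).

## Objects (existentially quantified in `CMPointGaloisPrinted`; J = journal page, AJM 21 (2017); p00NN = arXiv chunk)

For each block `d ∣ n` with `d ≡ 5, 6 (mod 8)` (then `H′_d ⊂ ℍ′_n = L_n(i)·∏_{d₀ ∣ n, d₀ ≡ 5,6} H′_{d₀}`, J739 = p0011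
L60–L62, so everything below lives in `D.H = ℍ′_n`): `z d` = the CM point `z_d = f_d(P_d) ∈ A(H′_d)` (J738); `Φ d` = the
set `Φ₀ ⊂ 2Cl′_d` (lifted to `ℍ′_n`) with `Z(d) = Σ_{t∈Φ₀} z_d^t` (J739); `ΓH' d = Gal(ℍ′_n/H′_d)`, `ΓH d = Gal(ℍ′_n/H_d)`;
`σ d` = a lift of "the unique order-two element `σ` of `Gal(H′_d/H_d)`" (J738); for `d ≡ 6 (mod 8)` also `θ d` = a lift
of `σ_{1+ϖ}` (Prop. 3.2 (2)); and ONE complex conjugation `c` on `ℍ′_n` ("`z̄_n` denotes the complex conjugate", J741).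
For a block `d ≡ 7 (mod 8)` only `Z(d) ∈ A(L_d)` is displayed (J759; `H_d ⊄ ℍ′_n` in general, so no `z_d` there).
«`g` acts trivially on `L_d(i) = ℚ(i, √d′ : d′ ∣ d)`» (J759 L29–L31) is rendered `TrivialOnL`: `g(i) = i` and
`g(√−d′) = √−d′` for `1 < d′ ∣ d`; «`g` acts trivially on the genus field `L_d`» is rendered `FixesGenusField`:
`g(√−d) = √−d` and `g(√(d′*)) = √(d′*)` for odd `1 < d′ ∣ d`, `d′* = (−1)^{(d′−1)/2}d′` (J725 L11–L16), with
`√(d′*) := i·√−d′` (`d′ ≡ 1 (4)`) / `√−d′` (`d′ ≡ 3 (4)`) (`genusRoot`).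

## Conjuncts and their printed sources (blocks `d ≡ 5, 6 (mod 8)` unless said otherwise)

* (G1) "Set `Φ₀ = Φ ∩ (2Cl′_n)` … Define the genus point `Z(n) := Σ_{t∈Φ₀} f_n(P_n)^t ∈ A(H′_n)`" (J739 = p0011 L53–L58),
  "`(2Cl′_n)/⟨σ⟩ ≅ 2Cl_n`" (J738), "Write `Φ₀ = {t_i : i = 1, ⋯, g(n)}`" (J759 L61), `g(n) = #2Cl_n` (§1): `Z(d) = Σ_{t∈Φ d} t·z_d`,
  `#(Φ d) = g(d)` (`gK d`).
* (G2) "`Φ₀ = Φ ∩ (2Cl′_n)`" with "the subfield of `H′_n` fixed by `2Cl′_n` is `L_n, L_n(i), L_n` according to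
  `n ≡ 5, 6, 7 (mod 8)`. The field `L_n(i) = ℚ(i, √d : d ∣ n)`" (J759 L25–L31; for `n ≡ 5`, `i ∈ L_n` since `−4n = (−4)·n*`):
  every `t ∈ Φ d` is `TrivialOnL d`.
* (G3) `ΓH' d = Gal(ℍ′_n/H′_d)`: "`z_n ∈ A(K_n^{ab})` … `H′_n = H_n(z_n)`" (J738 = p0010 L104–L107): fixes `z_d`; abelian over
  `K_d` (`H′_d ⊂ K_d^{ab}`; Prop. 3.2 (1)(2): `H′_n(√2)` resp. `H′_n` "is the ring class field of conductor `4` over `K_n`"):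
  commutators of two automorphisms fixing `√−d` lie in `ΓH' d`; `H′_d/ℚ` Galois (stable under `c` by Thm. 3.6 (1)(2); a
  subfield of `K_d^{ab}`) [textbook: Cox, Lemma 9.3 — ring class fields are Galois over `ℚ`]: `ΓH' d` is normal.
* (G4) `ΓH d = Gal(ℍ′_n/H_d) ⊇ ΓH' d` ("`H′_n = H_n(z_n)`", J738) fixes `K_d` and the genus field: "For any decomposition
  `n = d₁·d₂` with `d₂` positive and odd, we have an unramified quadratic extension `K_n(√d₂*)` of `K_n` where
  `d₂* = (−1)^{(d₂−1)/2}d₂`" (J725 L11–L16) inside "the Hilbert class field `H_n`" (J738) [textbook: Cox, Thm. 6.1]: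
  every `γ ∈ ΓH d` is `FixesGenusField d`.
* (G5) complex conjugation on the block: "`(2P(d₀,d₁))^c = Σ_{t∈Cl_n}(2z̄_n)^{1/t}`" (proof of Lemma 3.15, J750 = p0015
  L106–L110: `c t = t⁻¹ c` on `Gal(H′_n/K_n)`) [textbook: Cox, Lemma 9.3 — `c` inverts the Galois group of a ring class
  field over `K`]: `c t c t ∈ ΓH' d` for every `t` fixing `√−d`; Thm. 3.6 (1) "`z̄_n = −z_n + τ(1)`" (`n ≡ 5`), Thm. 3.6 (2)
  "`z̄_n = −z_n`" (`n ≡ 6`) (J741 = p0012 L28, L32).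
* (G6) "Let `σ` be the unique order-two element of `Gal(H′_n/H_n)` in the case `n ≡ 5, 6 (mod 8)`" (J738 = p0011 L3–L4):
  `σ d ∈ ΓH d`, `(σ d)² ∈ ΓH' d`; Prop. 3.2 (1) "`Gal(H′_n/H_n) ≃ ℤ/2ℤ` is generated by `σ_ϖ²`" with Thm. 3.6 (1) "Thus
  `z_n^{σ_ϖ²} = z_n + τ(1)`" (`n ≡ 5`); Prop. 3.2 (2) "`Gal(H′_n/H_n) ≃ ℤ/4ℤ` is generated by `σ_{1+ϖ}`" with Thm. 3.6 (2)
  "Thus `z_n^{σ²_{1+ϖ}} = z_n + τ(1)`" (`n ≡ 6`) (J741): `σ·z_d = z_d + τ(1)` (exact: `τ(1) = (0,0)`, `2τ(1) = 0`).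
* (G7) "`Φ₀` is a set of representatives of `2Cl_n = (2Cl′_n)/⟨σ⟩` in `2Cl′_n`" and "Since `α` acts trivially on `L_n(i)`,
  we see that `α ∈ 2Cl′_n`" (J759 L46, L57–L58): every automorphism `TrivialOnL d` is `≡ t` or `≡ tσ` modulo `ΓH' d` for
  one and only one `t ∈ Φ d`.
* (G8) (`d ≡ 6` only) `θ d` lifts `σ_{1+ϖ} ∈ Gal(K_d^{ab}/K_d)` (fixes `√−d`); Thm. 3.6 (2) "`z_n^{σ_{1+ϖ}} = z_n +
  τ((1−i)/2)`" (J741 = p0012 L31–L33) — displayed modulo `ℤτ(1)`, which is invariant under the WLOG normalisations of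
  `GenusPointDescentDisplays` (`im` = either root of `−1`: `τ((1±i)/2)` differ by `τ(1)`; `τ(1/2) = (2, ±4)`; `z ↦ −z`:
  `2τ((1−i)/2) = 0`); Prop. 3.2 (2): `σ_{1+ϖ}` generates `Gal(H′_n/H_n)` (so `θ d ∈ ΓH d`) and `σ²_{1+ϖ} = σ` ("The subfield
  of `H′_n` fixed by `σ²_{1+ϖ}` is `H_n(i)`"): `(θ d)²(σ d)⁻¹ ∈ ΓH' d`.
* (G9) (`d ≡ 7` only) Prop. 3.2 (3) "`H′_n = H_n`" and "In the case `n ≡ 7 (mod 8)`, `H′_n = H_n` and thus `Z(n)` is already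
  defined over `L_n`" (J759 L73–L75): every automorphism `FixesGenusField d` fixes `Z(d)`.
* (G10) `c`: `c(i) = −i`, `c(√−d′) = −√−d′` (`d′ ∣ n`), `c² = 1` (complex conjugation restricted to the Galois field `ℍ′_n`).

All point identities are read in `A(ℍ′_n)` under the WLOG normalisations of `GenusPointDescentDisplays` (module docstring
there: `τ(1/2) := (2, 4)`, `im` either root; replacing the identification `i₀` by `[−1]∘i₀` negates `z, Z, P` — (G1) is
linear, (G5)/(G6) are invariant since `−τ(1) = τ(1)`, (G8) as said).  NOT displayed: Thm. 3.6 (1)'s `z^{σ_ϖ} = z +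
τ((1+i)/2)`, `z^{σ_{1+2ϖ}} = z`, Thm. 3.6 (2)'s `z^{σ_ϖ} = z + τ(−i/2)`, Thm. 3.6 (3), Prop. 3.2 (4), the explicit
matrices/CM points of §3.2, any reciprocity-law VALUE (e.g. `σ_{1+ϖ}(i) = −i` is NOT displayed — it is derivable from (G8),
see the cell's `P2/…ThetaGaloisBookkeeping.lean`).  No Hilbert symbol, no cell computation, no statement of the cell's
proofs is a conjunct.

References: [TianYuanZhang2017] §2.1 (J725), §3.1 (J738–J739 = p0010 L99–L115, p0011 L1–L73), Prop. 3.2, Thm. 3.6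
(J741 = p0012 L22–L36), proof of Lemma 3.15 (J750), proof of Lemma 3.21 (J759 = p0020 L50–L63); D. A. Cox, *Primes of the
form x² + ny²* (2nd ed.), Thm. 6.1 (genus field = maximal unramified extension abelian over `ℚ`), Lemma 9.3 (ring class
fields are generalized dihedral over `ℚ`) [Cox2013]; cell files HOME/lit/tyz2017/TYZ2017-STATEMENTS.md,
HOME/lean/THETA-PRINTED-FAITHFULNESS.md, HOME/lean/CMGALOIS-FAITHFULNESS.md (per-conjunct locator table for this file).
-/

noncomputable section

open scoped Classical

open WeierstrassCurve Finset

namespace Literature.NumberTheory.EllipticCurves.TianYuanZhang2017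

namespace GenusPointData

variable {n : ℕ}

/-! ## §1 Vocabulary: the Galois action on `A(ℍ′_n)`, the genus-field generators `√(d′*)`, "trivial on `L_d(i)` / `L_d`" -/

/-- `γ ∈ Gal(ℍ′_n/ℚ)` acting on `A(ℍ′_n)` (the paper's `R ↦ R^γ`; the standard action `Affine.Point.map` of an
automorphism of `H` on the `H`-points of the `ℚ`-curve `A`, an additive map).
[cite: TianYuanZhang2017, §3.1 (p0011 L53–L58: Z(n) := Σ_{t∈Φ₀} f_n(P_n)^t) and proof of Thm. 3.5 (2) (p0020 L22–L24)] -/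
def galPt (D : GenusPointData n) (g : D.H ≃ₐ[ℚ] D.H) : APoint D.H →+ APoint D.H :=
  WeierstrassCurve.Affine.Point.map (W' := curveA) g.toAlgHom

/-- `√(d′*)` for an odd divisor `d′`, `d′* = (−1)^{(d′−1)/2} d′` ("as before"): `i·√−d′` if `d′ ≡ 1 (mod 4)` (a square root
of `d′`), `√−d′` if `d′ ≡ 3 (mod 4)`. (For even `d′` the value is not used.)
[cite: TianYuanZhang2017, §2.1 (J725 L11–L16: d₂* = (−1)^{(d₂−1)/2} d₂) and Thm. 3.3 (p0011 L44–L47: d₁* as before)] -/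
def genusRoot (D : GenusPointData n) (d' : ℕ) : D.H :=
  if d' % 4 = 1 then D.im * D.sqrtNeg d' else D.sqrtNeg d'

/-- `(√(d′*))² = d′*`: for an odd divisor `d′` of `n`, `genusRoot d′` squares to `d′` if `d′ ≡ 1 (mod 4)` and to `−d′` if
`d′ ≡ 3 (mod 4)`. [cite: TianYuanZhang2017, §2.1 (J725 L11–L16)] -/
theorem genusRoot_sq (D : GenusPointData n) {d' : ℕ} (hd' : d' ∈ n.divisors) (hodd : Odd d') :
    D.genusRoot d' ^ 2 = if d' % 4 = 1 then ((d' : ℕ) : D.H) else -((d' : ℕ) : D.H) := by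
  have hsq := D.sqrtNeg_sq d' hd'
  unfold genusRoot
  rcases Nat.odd_mod_four_iff.mp (Nat.odd_iff.mp hodd) with h1 | h3
  · rw [if_pos h1, if_pos h1, mul_pow, D.im_sq, hsq]; ring
  · have h1 : ¬ d' % 4 = 1 := by omega
    rw [if_neg h1, if_neg h1, hsq]

/-- **«`g` acts trivially on `L_d(i) = ℚ(i, √d′ : d′ ∣ d)`»** (J759 L29–L31: "The field `L_n(i) = ℚ(i, √d : d ∣ n)`"; the
subfield of `H′_d` fixed by `2Cl′_d` for `d ≡ 5, 6 (mod 8)`, J759 L25–L28, `L_d(i) = L_d` for `d ≡ 5`): `g(i) = i` and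
`g(√−d′) = √−d′` for every divisor `1 < d′` of `d` (with `i` fixed, fixing `√d′` and fixing `√−d′` are the same).
[cite: TianYuanZhang2017, proof of Lemma 3.21 (J759 = p0020 L55–L58)] -/
def TrivialOnL (D : GenusPointData n) (d : ℕ) (g : D.H ≃ₐ[ℚ] D.H) : Prop :=
  g D.im = D.im ∧ ∀ d' ∈ d.divisors, 1 < d' → g (D.sqrtNeg d') = D.sqrtNeg d'

/-- **«`g` acts trivially on the genus field `L_d` of `K_d = ℚ(√−d)`»**: `g(√−d) = √−d` and `g(√(d′*)) = √(d′*)` for every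
odd divisor `1 < d′` of `d` ("the genus field `L_n` is the subfield of `H_n` fixed by `2Cl_n`", J759 L25; `L_n = K_n(√d₂* :
d₂ ∣ n odd)` by "an unramified quadratic extension `K_n(√d₂*)` of `K_n`", J725 L11–L16, and `[L_n : K_n] = 2^{h₂(n)}`).
[cite: TianYuanZhang2017, §2.1 (J725 L11–L16) and proof of Lemma 3.21 (J759 = p0020 L55–L56)] -/
def FixesGenusField (D : GenusPointData n) (d : ℕ) (g : D.H ≃ₐ[ℚ] D.H) : Prop :=
  g (D.sqrtNeg d) = D.sqrtNeg d ∧ ∀ d' ∈ d.divisors, Odd d' → 1 < d' → g (D.genusRoot d') = D.genusRoot d'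

/-! ## §2 The printed sentences, per block -/

/-- **The CM-point layer of a block `d ≡ 5, 6 (mod 8)`** (conjuncts (G1)–(G7) of the module docstring, each ONE printed
sentence of [TianYuanZhang2017] §3.1 / Prop. 3.2 / Thm. 3.6 / p. 750 / p. 759, or the textbook genus/ring-class-field
theorem the source uses in words) on the objects `z = z_d`, `Φ = Φ₀^{(d)}`, `ΓH = Gal(ℍ′_n/H_d)`, `ΓH' = Gal(ℍ′_n/H′_d)`,
`σ` (order two on `H′_d`), `c` (complex conjugation):
(G1) `Z(d) = Σ_{t∈Φ₀} z_d^t`, `#Φ₀ = g(d)`; (G2) `Φ₀ ⊂ 2Cl′_d` is trivial on `L_d(i)`; (G3) `Gal(ℍ′_n/H′_d)` fixes `z_d`, is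
normal, contains the commutators of `K_d`-automorphisms; (G4) `Gal(ℍ′_n/H′_d) ⊂ Gal(ℍ′_n/H_d)`, which is trivial on the
genus field; (G5) `c` inverts `Gal(H′_d/K_d)`, `z̄_d = −z_d + τ(1)` (`d ≡ 5`) / `z̄_d = −z_d` (`d ≡ 6`); (G6) `σ ∈ Gal(H′_d/H_d)`,
`σ² = 1` on `H′_d`, `z_d^σ = z_d + τ(1)`; (G7) `Φ₀` represents `2Cl′_d/⟨σ⟩ = Gal(H′_d/L_d(i))/⟨σ⟩` exactly once.
A predicate; nothing asserted.
[cite: TianYuanZhang2017, §3.1 (J738–J739 = p0010 L104–L115, p0011 L1–L13, L53–L58), Prop. 3.2 (1)(2), Thm. 3.6 (1)(2) (J741 = p0012 L22–L36), proof of Lemma 3.15 (J750 = p0015 L106–L110), proof of Lemma 3.21 (J759 = p0020 L50–L63), §2.1 (J725 L11–L16)]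
[cite: Cox2013, Thm. 6.1 and Lemma 9.3] -/
def CMBlockSpec (D : GenusPointData n) (d : ℕ) (z : APoint D.H) (Φ : Finset (D.H ≃ₐ[ℚ] D.H))
    (ΓH ΓH' : Subgroup (D.H ≃ₐ[ℚ] D.H)) (σ c : D.H ≃ₐ[ℚ] D.H) : Prop :=
  -- (G1) "Z(n) := Σ_{t∈Φ₀} f_n(P_n)^t", "Φ₀ = {t_i : i = 1, ⋯, g(n)}"
  (D.Z d = ∑ t ∈ Φ, D.galPt t z ∧ Φ.card = gK d) ∧
  -- (G2) "Φ₀ = Φ ∩ (2Cl′_n)", "the subfield of H′_n fixed by 2Cl′_n is L_n, L_n(i), L_n (n ≡ 5, 6, 7)", "L_n(i) = ℚ(i, √d : d | n)"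
  (∀ t ∈ Φ, D.TrivialOnL d t) ∧
  -- (G3) Gal(ℍ′_n/H′_d): "z_n ∈ A(K_n^ab) … H′_n = H_n(z_n)"; H′_n ⊂ K_n^ab (abelian over K_n); H′_n Galois over ℚ
  ((∀ γ ∈ ΓH', D.galPt γ z = z) ∧ (∀ g γ : D.H ≃ₐ[ℚ] D.H, γ ∈ ΓH' → g * γ * g⁻¹ ∈ ΓH') ∧
    (∀ s t : D.H ≃ₐ[ℚ] D.H, s (D.sqrtNeg d) = D.sqrtNeg d → t (D.sqrtNeg d) = D.sqrtNeg d →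
      s⁻¹ * t⁻¹ * s * t ∈ ΓH')) ∧
  -- (G4) Gal(ℍ′_n/H_d) ⊇ Gal(ℍ′_n/H′_d); H_n ⊃ L_n ⊃ K_n(√d₂*) (genus theory, J725) ⊃ K_n
  ((∀ γ ∈ ΓH', γ ∈ ΓH) ∧ (∀ γ ∈ ΓH, D.FixesGenusField d γ)) ∧
  -- (G5) "(2P(d₀,d₁))^c = Σ_{t∈Cl_n}(2z̄_n)^{1/t}" (c inverts Gal(H′_n/K_n)); Thm 3.6 (1) "z̄_n = −z_n + τ(1)" / (2) "z̄_n = −z_n"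
  ((∀ t : D.H ≃ₐ[ℚ] D.H, t (D.sqrtNeg d) = D.sqrtNeg d → c * t * c * t ∈ ΓH') ∧
    (d % 8 = 5 → D.galPt c z = -z + tauOne) ∧ (d % 8 = 6 → D.galPt c z = -z)) ∧
  -- (G6) "σ the unique order-two element of Gal(H′_n/H_n)"; Thm 3.6 (1)/(2) "Thus z_n^{σ_ϖ²} = z_n + τ(1)" / "Thus z_n^{σ²_{1+ϖ}} = z_n + τ(1)"
  (σ ∈ ΓH ∧ σ * σ ∈ ΓH' ∧ D.galPt σ z = z + tauOne) ∧
  -- (G7) "Φ₀ is a set of representatives of 2Cl_n = (2Cl′_n)/⟨σ⟩ in 2Cl′_n"; "α acts trivially on L_n(i) ⟹ α ∈ 2Cl′_n"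
  ((∀ g : D.H ≃ₐ[ℚ] D.H, D.TrivialOnL d g → ∃ t ∈ Φ, g * t⁻¹ ∈ ΓH' ∨ g * (t * σ)⁻¹ ∈ ΓH') ∧
    (∀ t₁ ∈ Φ, ∀ t₂ ∈ Φ, (t₁ * t₂⁻¹ ∈ ΓH' ∨ t₁ * (t₂ * σ)⁻¹ ∈ ΓH') → t₁ = t₂))

/-- **The element `σ_{1+ϖ}` of a block `d ≡ 6 (mod 8)`** (conjunct (G8)): a lift `θ` to `ℍ′_n` of `σ_{1+ϖ} ∈
Gal(K_d^{ab}/K_d)` — fixes `√−d`; Thm. 3.6 (2) "`z_n^{σ_{1+ϖ}} = z_n + τ((1−i)/2)`" read modulo `ℤτ(1)` (invariant under the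
WLOG normalisations `im = ±i`, `τ(1/2) = (2, ±4)`, `z ↦ −z`); Prop. 3.2 (2) "`Gal(H′_n/H_n) ≃ ℤ/4ℤ` is generated by
`σ_{1+ϖ}` … The subfield of `H′_n` fixed by `σ²_{1+ϖ}` is `H_n(i)`": `θ` is trivial on `H_d` and `θ² ≡ σ` (the order-two
element) modulo `Gal(ℍ′_n/H′_d)`. A predicate; nothing asserted.
[cite: TianYuanZhang2017, Prop. 3.2 (2) (J738 = p0010 L111–L113) and Thm. 3.6 (2) (J741 = p0012 L31–L33)] -/
def ThetaBlockSpec (D : GenusPointData n) (d : ℕ) (z : APoint D.H) (ΓH ΓH' : Subgroup (D.H ≃ₐ[ℚ] D.H))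
    (σ θ : D.H ≃ₐ[ℚ] D.H) : Prop :=
  θ (D.sqrtNeg d) = D.sqrtNeg d ∧
    (∃ m₀ : ℤ, D.galPt θ z = z + D.tauHalfOneMinusI + m₀ • tauOne) ∧
    θ ∈ ΓH ∧ θ * θ * σ⁻¹ ∈ ΓH'

/-- **A block `d ≡ 7 (mod 8)`** (conjunct (G9)): Prop. 3.2 (3) "`H′_n = H_n`" and "In the case `n ≡ 7 (mod 8)`, `H′_n = H_n`
and thus `Z(n)` is already defined over `L_n`" — every automorphism of `ℍ′_n` trivial on the genus field `L_d` fixes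
`Z(d)`. A predicate; nothing asserted.
[cite: TianYuanZhang2017, Prop. 3.2 (3) (J738) and proof of Lemma 3.21 (J759 = p0020 L62–L63)] -/
def SevenBlockSpec (D : GenusPointData n) (d : ℕ) : Prop :=
  ∀ g : D.H ≃ₐ[ℚ] D.H, D.FixesGenusField d g → D.galPt g (D.Z d) = D.Z d

/-- **Complex conjugation restricted to `ℍ′_n`** (conjunct (G10); "`z̄_n` denotes the complex conjugate of `z_n`", Thm. 3.6):
`c(i) = −i`, `c(√−d′) = −√−d′` for `d′ ∣ n`, `c² = 1`. A predicate; nothing asserted.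
[cite: TianYuanZhang2017, Thm. 3.6 (J741 = p0012 L22–L36)] -/
def ConjSpec (D : GenusPointData n) (c : D.H ≃ₐ[ℚ] D.H) : Prop :=
  c D.im = -D.im ∧ (∀ d' ∈ n.divisors, c (D.sqrtNeg d') = -D.sqrtNeg d') ∧ c * c = 1

/-- **Tian–Yuan–Zhang §3.1–3.2 / Prop. 3.2 / Thm. 3.6 / p. 759 on the data `D`, all blocks** (see the module docstring):
there are CM points `z_d`, representative sets `Φ₀^{(d)}`, subgroups `Gal(ℍ′_n/H_d) ⊇ Gal(ℍ′_n/H′_d)`, lifts `σ^{(d)}` (and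
`θ^{(d)} = σ_{1+ϖ}` for `d ≡ 6`) and a complex conjugation `c` such that `ConjSpec c`, `CMBlockSpec` holds for every block
`d ∣ n` with `d ≡ 5, 6 (mod 8)`, `ThetaBlockSpec` for every block `d ≡ 6 (mod 8)`, and `SevenBlockSpec` for every block
`d ≡ 7 (mod 8)`. (Values of the object-functions at non-blocks are unconstrained.) A predicate; nothing asserted.
[cite: TianYuanZhang2017, §3.1 (J738–J739), Prop. 3.2 (1)(2)(3), Thm. 3.6 (1)(2) (J741), proof of Lemma 3.15 (J750), proof of Lemma 3.21 (J759), §2.1 (J725)]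
[cite: Cox2013, Thm. 6.1 and Lemma 9.3] -/
def CMPointGaloisPrinted (D : GenusPointData n) : Prop :=
  ∃ (z : ℕ → APoint D.H) (Φ : ℕ → Finset (D.H ≃ₐ[ℚ] D.H)) (ΓH ΓH' : ℕ → Subgroup (D.H ≃ₐ[ℚ] D.H))
    (σ θ : ℕ → (D.H ≃ₐ[ℚ] D.H)) (c : D.H ≃ₐ[ℚ] D.H),
    D.ConjSpec c ∧
    ∀ d ∈ n.divisors,
      ((d % 8 = 5 ∨ d % 8 = 6) → D.CMBlockSpec d (z d) (Φ d) (ΓH d) (ΓH' d) (σ d) c) ∧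
      (d % 8 = 6 → D.ThetaBlockSpec d (z d) (ΓH d) (ΓH' d) (σ d) (θ d)) ∧
      (d % 8 = 7 → D.SevenBlockSpec d)

end GenusPointData

/-! ## §3 The ONE named fact, and its relation to `tyz_genusPointData` -/

/-- **Tian–Yuan–Zhang 2017, §3 with the CM-point layer of §3.1–3.2, Prop. 3.2, Thm. 3.6 (1)(2) and p. 759, AS PRINTED, as ONE
named fact**: for every positive square-free `n ≡ 5, 6, 7 (mod 8)` there are data `D : GenusPointData n` (the field `ℍ′_n`,
`i`, `√−d`, `β′`, the genus points `Z(d₀)`, the points `P(d)`, signs) satisfying the displayed statements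
`GenusPointData.Printed` (Prop. 3.4, Thm. 3.5, Lemma 3.18, Lemma 3.21, the Galois facts on `β′`) AND
`GenusPointData.CMPointGaloisPrinted` (for every block: the CM point `z_d` with `Z(d) = Σ_{t∈Φ₀} z_d^t`, `#Φ₀ = g(d)`,
`Φ₀ ⊂ 2Cl′_d = Gal(H′_d/L_d(i))` representing `2Cl′_d/⟨σ⟩`, `Gal(ℍ′_n/H′_d)` normal with `H′_d/K_d` abelian, genus theory in
`H_d`, complex conjugation inverting `Gal(H′_d/K_d)` with Thm. 3.6's `z̄_d`, the order-two `σ` with `z_d^σ = z_d + τ(1)`, for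
`d ≡ 6` the lift of `σ_{1+ϖ}` with Thm. 3.6 (2), and for `d ≡ 7` `Z(d) ∈ A(L_d)`).  Constructed in the source from the CM
points on `X_U → A` (§3.1–3.2), Yuan–Zhang–Zhang's Gross–Zagier formula (Thm. 3.3) and class field theory; no `_holds`
expected.  Implies `tyz_genusPointData`.  Consumers take it as an explicit hypothesis; nothing is asserted here.
[cite: TianYuanZhang2017, §3: §3.1 (J738–J739), Prop. 3.2, Prop. 3.4, Thm. 3.5, Thm. 3.6 (J741), Lemma 3.18, Lemma 3.21 and its proof (J759), proof of Lemma 3.15 (J750), §2.1 (J725)]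
[cite: Cox2013, Thm. 6.1 and Lemma 9.3] -/
def tyz_cmPointGaloisData : Prop :=
  ∀ (n : ℕ), Squarefree n → (n % 8 = 5 ∨ n % 8 = 6 ∨ n % 8 = 7) →
    ∃ D : GenusPointData n, D.Printed ∧ D.CMPointGaloisPrinted

/-- `tyz_cmPointGaloisData` refines `tyz_genusPointData` (drop the CM-point layer). [cite: TianYuanZhang2017, §3] -/
theorem tyz_genusPointData_of_cmPointGaloisData (h : tyz_cmPointGaloisData) : tyz_genusPointData := by
  intro n hn h8
  obtain ⟨D, hD, -⟩ := h n hn h8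
  exact ⟨D, hD⟩

end Literature.NumberTheory.EllipticCurves.TianYuanZhang2017

end
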